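import Summits.Schanuel.Schanuel.Theses.RootDecomp1G

/-!
# RootDecomp1G — round-4 glue «ScopeCarving»: `CMKernelStep → LogKernelStep → DarkKernelStep → KernelClassStep`

Proves the D-0019 glue item `KernelClassStepGlue` (stmt-Schanuel-29026) of the split of the round-3 residual `KernelClassStep`
(stmt-Schanuel-28456) into `CMKernelStep` (K_CM, stmt-Schanuel-29023), `LogKernelStep` (K_log, 29024) and `DarkKernelStep`
(K_dark, 29025, the declared residual of round 4): a classical case split on the two scope predicates («every e^{z_j}
algebraic»; «π√d ∈ span_ℚ z for some d ≥ 1»).  No transcendence input.  Port of the lens-6 gen-5 hand-off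
`HOME/decomp-schanuel-lens-6/g5/prover/RootDecomp1GScopeSplit.port.lean` by the census seat (prover role): the three LOCAL COPY defs
deleted (route constants since rev 9), the theorem retyped on the route's glue decl; this file defines nothing; 0 sorry.
-/

set_option linter.dupNamespace false

noncomputable section

namespace Summit.Schanuel.Schanuel.Theorems.RootDecomp1GScopeSplit

open Summit.Schanuel.Schanuel.Theses.RootDecomp1G

/-- Item stmt-Schanuel-29026 (glue of the split of `KernelClassStep`): case split on the two scopes. -/
theorem kernelClassStepGlue_holds : KernelClassStepGlue := by
  intro hCM hL hD n z haxis hli ih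
  by_cases hlog : ∀ j, IsAlgebraic ℚ (Complex.exp (z j))
  · exact hL n z haxis hli hlog ih
  · by_cases hcm : ∃ d : ℕ, 0 < d ∧ ((Real.pi * Real.sqrt d : ℝ) : ℂ) ∈ Submodule.span ℚ (Set.range z)
    · exact hCM n z haxis hli hcm ih
    · exact hD n z haxis hli hcm hlog ih

end Summit.Schanuel.Schanuel.Theorems.RootDecomp1GScopeSplit

end
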